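import Mathlib
import Literature.MathematicalPhysics.StatisticalMechanics.OneCrossingMixture
import Summits.AtomisticToContinuum.Crystallization.Theorems.ThreeConeCertificateExactCertificateTransfer1DClassBounds

/-!
# Crux `ExactCertificate` (stmt-AtomisticToContinuum-11959), line `closure-makes-nogap-exact`,
# Transfer skeleton VII (`OneCrossingChainCrystallizes`): stub `stub_zeroPressure_of_isMinOn`

Support file for the crux `ThreeConeCertificate.ExactCertificate`, d = 1 Transfer skeleton VII
`Cruxes.ExactCertificate.Transfer1D.OneCrossingChainCrystallizes`.  For a pair potential
`V(r) = −∫₀^∞ e^{−tr} p(t) dt` of the one-crossing Laplace class (measurable density `p` with the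
polynomial envelope `|p(t)| ≤ C (t² + t^M)`, `M ≥ 2`) we show that a minimiser `a > 0` of the chain
energy `e(b) := Σ'_k V((k+1) b)` over `(0, ∞)` is a ZERO-PRESSURE spacing:
`Σ_k (k+1) ∫₀^∞ e^{−t(k+1)a} p(t) t dt = 0`.

* `zeroPressure_hasDerivAt_potential` — `V` is differentiable on `(0, ∞)` with
  `V'(r) = ∫₀^∞ e^{−tr} p(t) t dt` (differentiation under the integral sign);
* `zeroPressure_envelope_abs_mul` — the modified density `|p(t)| t` satisfies the envelope with
  constant `2C` and exponent `M + 1` (so the `ClassBounds` lemmas apply to it);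
* `zeroPressure_abs_moment_le` — `|V'(r)| ≤ ∫₀^∞ e^{−t r₀} |p(t)| t dt` for `0 < r₀ ≤ r`;
* `stub_zeroPressure_of_isMinOn` — termwise differentiation of the chain energy on `(a/2, ∞)`
  (`hasDerivAt_tsum_of_isPreconnected`) and Fermat's theorem at the interior minimiser `a`.

All `[folklore]`.
-/

noncomputable section

namespace Summit.AtomisticToContinuum.Crystallization.Theorems.ThreeConeCertificateExactCertificate.Transfer1D

open Literature.MathematicalPhysics.StatisticalMechanics MeasureTheory Set Filter Topology
open scoped BigOperators

/-! ## Differentiation of the potential under the integral sign -/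

/-- **Derivative of the Laplace-class potential.** Under the envelope `|p(t)| ≤ C(t² + t^M)`,
measurability of `p` and `V(r) = −∫₀^∞ e^{−tr} p(t) dt` on `(0, ∞)`, for every `r > 0` the potential
`V` has derivative `∫₀^∞ e^{−tr} p(t) t dt` at `r`: differentiate under the integral sign, the
`r`-derivative `e^{−ts} p(t) t` being dominated on `s > r/2` by the integrable `e^{−tr/2} |p(t)| t`.
[folklore] -/
theorem zeroPressure_hasDerivAt_potential {V p : ℝ → ℝ} {C : ℝ} {M : ℕ} (hpm : Measurable p)
    (hbd : ∀ t : ℝ, 0 < t → |p t| ≤ C * (t ^ 2 + t ^ M))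
    (hV : ∀ r : ℝ, 0 < r → V r = -(∫ t in Set.Ioi (0 : ℝ), Real.exp (-(t * r)) * p t))
    {r : ℝ} (hr : 0 < r) :
    HasDerivAt V (∫ t in Ioi (0 : ℝ), Real.exp (-(t * r)) * p t * t) r := by
  have hr2 : 0 < r / 2 := half_pos hr
  have hs : Ioi (r / 2) ∈ 𝓝 r := Ioi_mem_nhds (half_lt_self hr)
  -- measurability of the integrands
  have hmeasF : ∀ x : ℝ, AEStronglyMeasurable (fun t : ℝ => -(Real.exp (-(t * x)) * p t))
      (volume.restrict (Ioi 0)) := fun x => by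
    have h1 : Measurable fun t : ℝ => Real.exp (-(t * x)) :=
      Real.continuous_exp.measurable.comp ((measurable_id.mul_const x).neg)
    exact (h1.mul hpm).neg.aestronglyMeasurable
  have hmeasF' : AEStronglyMeasurable (fun t : ℝ => Real.exp (-(t * r)) * p t * t)
      (volume.restrict (Ioi 0)) := by
    have h1 : Measurable fun t : ℝ => Real.exp (-(t * r)) :=
      Real.continuous_exp.measurable.comp ((measurable_id.mul_const r).neg)
    exact ((h1.mul hpm).mul measurable_id).aestronglyMeasurable
  -- integrability at `r` and of the dominating function
  have hint : Integrable (fun t : ℝ => -(Real.exp (-(t * r)) * p t)) (volume.restrict (Ioi 0)) :=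
    (classBounds_integrableOn_zero hpm hbd hr).neg
  have hbound_int : Integrable (fun t : ℝ => ‖Real.exp (-(t * (r / 2))) * p t * t‖)
      (volume.restrict (Ioi 0)) :=
    (classBounds_integrableOn_one hpm hbd hr2).norm
  have h_bound : ∀ᵐ t ∂(volume.restrict (Ioi (0 : ℝ))), ∀ x ∈ Ioi (r / 2),
      ‖Real.exp (-(t * x)) * p t * t‖ ≤ ‖Real.exp (-(t * (r / 2))) * p t * t‖ := by
    refine (ae_restrict_mem measurableSet_Ioi).mono fun t ht x hx => ?_
    have ht : (0 : ℝ) < t := ht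
    have hx : r / 2 < x := hx
    have hexp : Real.exp (-(t * x)) ≤ Real.exp (-(t * (r / 2))) :=
      Real.exp_le_exp.2 (neg_le_neg (mul_le_mul_of_nonneg_left hx.le ht.le))
    rw [Real.norm_eq_abs, Real.norm_eq_abs, abs_mul, abs_mul, abs_mul, abs_mul,
      abs_of_nonneg (Real.exp_pos _).le, abs_of_nonneg (Real.exp_pos _).le, abs_of_nonneg ht.le]
    exact mul_le_mul_of_nonneg_right (mul_le_mul_of_nonneg_right hexp (abs_nonneg _)) ht.le
  -- the pointwise derivative in the parameter
  have h_diff : ∀ᵐ t ∂(volume.restrict (Ioi (0 : ℝ))), ∀ x ∈ Ioi (r / 2),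
      HasDerivAt (fun y : ℝ => -(Real.exp (-(t * y)) * p t)) (Real.exp (-(t * x)) * p t * t) x := by
    refine Filter.Eventually.of_forall fun t x _ => ?_
    have h1 : HasDerivAt (fun y : ℝ => -(t * y)) (-(t * 1)) x :=
      ((hasDerivAt_id' x).const_mul t).neg
    refine ((h1.exp.mul_const (p t)).neg).congr_deriv ?_
    ring
  have key := hasDerivAt_integral_of_dominated_loc_of_deriv_le (μ := volume.restrict (Ioi (0 : ℝ)))
    (F := fun (y : ℝ) (t : ℝ) => -(Real.exp (-(t * y)) * p t))
    (F' := fun (y : ℝ) (t : ℝ) => Real.exp (-(t * y)) * p t * t) (x₀ := r)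
    (bound := fun t : ℝ => ‖Real.exp (-(t * (r / 2))) * p t * t‖)
    hs (Filter.Eventually.of_forall hmeasF) hint hmeasF' h_bound hbound_int h_diff
  have hD : HasDerivAt (fun y : ℝ => ∫ t in Ioi (0 : ℝ), -(Real.exp (-(t * y)) * p t))
      (∫ t in Ioi (0 : ℝ), Real.exp (-(t * r)) * p t * t) r := key.2
  refine hD.congr_of_eventuallyEq ?_
  filter_upwards [Ioi_mem_nhds hr] with y hy
  simp only [hV y hy, integral_neg]

/-! ## The modified density `|p(t)| t` -/

/-- **Envelope of the modified density.** If `|p(t)| ≤ C(t² + t^M)` on `t > 0` with `M ≥ 2`, then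
`|p(t)| t ≤ 2C (t² + t^{M+1})` on `t > 0` (since `t³ ≤ t² + t^{M+1}`). [folklore] -/
theorem zeroPressure_envelope_abs_mul {p : ℝ → ℝ} {C : ℝ} {M : ℕ} (hM : 2 ≤ M)
    (hbd : ∀ t : ℝ, 0 < t → |p t| ≤ C * (t ^ 2 + t ^ M)) :
    ∀ t : ℝ, 0 < t → |(|p t| * t)| ≤ 2 * C * (t ^ 2 + t ^ (M + 1)) := by
  intro t ht
  have hC := classBounds_C_nonneg hbd
  rw [abs_mul, abs_abs, abs_of_pos ht]
  have h3 : t ^ 3 ≤ t ^ 2 + t ^ (M + 1) := by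
    rcases le_or_gt t 1 with h | h
    · have : t ^ 3 ≤ t ^ 2 := pow_le_pow_of_le_one ht.le h (by norm_num)
      linarith [pow_nonneg ht.le (M + 1)]
    · have : t ^ 3 ≤ t ^ (M + 1) := pow_le_pow_right₀ h.le (by omega)
      linarith [pow_nonneg ht.le 2]
  have h2 : 0 ≤ C * t ^ 2 := mul_nonneg hC (pow_nonneg ht.le 2)
  calc |p t| * t ≤ C * (t ^ 2 + t ^ M) * t := mul_le_mul_of_nonneg_right (hbd t ht) ht.le
    _ = C * (t ^ 3 + t ^ (M + 1)) := by ring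
    _ ≤ C * (t ^ 2 + t ^ (M + 1) + t ^ (M + 1)) :=
        mul_le_mul_of_nonneg_left (by linarith) hC
    _ ≤ 2 * C * (t ^ 2 + t ^ (M + 1)) := by linarith

/-- **Monotone domination of the moment.** For `0 < r₀ ≤ r`:
`|∫₀^∞ e^{−tr} p(t) t dt| ≤ ∫₀^∞ e^{−t r₀} |p(t)| t dt`. [folklore] -/
theorem zeroPressure_abs_moment_le {p : ℝ → ℝ} {C : ℝ} {M : ℕ} (hM : 2 ≤ M) (hpm : Measurable p)
    (hbd : ∀ t : ℝ, 0 < t → |p t| ≤ C * (t ^ 2 + t ^ M)) {r₀ r : ℝ} (hr₀ : 0 < r₀) (hle : r₀ ≤ r) :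
    |∫ t in Ioi (0 : ℝ), Real.exp (-(t * r)) * p t * t|
      ≤ ∫ t in Ioi (0 : ℝ), Real.exp (-(t * r₀)) * (|p t| * t) := by
  have hpm' : Measurable fun t : ℝ => |p t| * t :=
    (continuous_abs.measurable.comp hpm).mul measurable_id
  have hint : IntegrableOn (fun t : ℝ => Real.exp (-(t * r₀)) * (|p t| * t)) (Ioi 0) :=
    classBounds_integrableOn_zero hpm' (zeroPressure_envelope_abs_mul hM hbd) hr₀
  have h := norm_integral_le_of_norm_le (μ := volume.restrict (Ioi (0 : ℝ)))
    (f := fun t : ℝ => Real.exp (-(t * r)) * p t * t) hint ?_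
  · simpa only [Real.norm_eq_abs] using h
  · refine (ae_restrict_mem measurableSet_Ioi).mono fun t ht => ?_
    have ht : (0 : ℝ) < t := ht
    have hexp : Real.exp (-(t * r)) ≤ Real.exp (-(t * r₀)) :=
      Real.exp_le_exp.2 (neg_le_neg (mul_le_mul_of_nonneg_left hle ht.le))
    rw [Real.norm_eq_abs, abs_mul, abs_mul, abs_of_nonneg (Real.exp_pos _).le, abs_of_nonneg ht.le,
      mul_assoc]
    exact mul_le_mul_of_nonneg_right hexp (mul_nonneg (abs_nonneg _) ht.le)

/-! ## The registered stub -/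

/-- **STUB `stub_zeroPressure_of_isMinOn` — A MINIMISER OF THE CHAIN ENERGY IS AT ZERO PRESSURE**
(registered stub of Transfer skeleton VII).  For `V(r) = −∫₀^∞ e^{−tr} p(t) dt` of the one-crossing
Laplace class (`p` measurable, `|p(t)| ≤ C(t² + t^M)`, `M ≥ 2`), if the chain energy
`b ↦ Σ'_k V((k+1) b)` attains its minimum over `(0, ∞)` at `a > 0`, then
`Σ_k (k+1) ∫₀^∞ e^{−t(k+1)a} p(t) t dt = 0` (as a `HasSum`).  Proof: `V'(r) = ∫₀^∞ e^{−tr}p(t)t dt`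
(differentiation under the integral sign); the chain energy is differentiable termwise on `(a/2, ∞)`,
the derivatives `(k+1) V'((k+1)b)` being dominated by the summable `(k+1) ∫ e^{−t(k+1)a/2}|p|t`
(`classBounds_summable_weighted` for the modified density `|p(t)| t`); Fermat's theorem at the
interior minimiser `a` makes the derivative `Σ'_k (k+1) V'((k+1)a)` vanish. [folklore] -/
theorem stub_zeroPressure_of_isMinOn : ∀ (V p : ℝ → ℝ) (C a : ℝ) (M : ℕ), 2 ≤ M → Measurable p →
    (∀ t : ℝ, 0 < t → |p t| ≤ C * (t ^ 2 + t ^ M)) →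
    (∀ r : ℝ, 0 < r → V r = -(∫ t in Set.Ioi (0 : ℝ), Real.exp (-(t * r)) * p t)) →
    0 < a → IsMinOn (fun b : ℝ => ∑' k : ℕ, V (((k : ℝ) + 1) * b)) (Set.Ioi 0) a →
    HasSum (fun k : ℕ => ((k : ℝ) + 1) *
      ∫ t in Set.Ioi (0 : ℝ), Real.exp (-(t * (((k : ℝ) + 1) * a))) * p t * t) 0 := by
  intro V p C a M hM hpm hbd hV ha hmin
  -- the half-line `(a/2, ∞)` on which we differentiate termwise
  have ha2 : 0 < a / 2 := half_pos ha
  have hmem : a ∈ Ioi (a / 2) := half_lt_self ha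
  -- the modified density `|p| t` and its envelope
  have hpm' : Measurable fun t : ℝ => |p t| * t :=
    (continuous_abs.measurable.comp hpm).mul measurable_id
  have hbd' := zeroPressure_envelope_abs_mul hM hbd
  have hM' : 2 ≤ M + 1 := by omega
  -- the summable bound of the termwise derivatives
  have hu : Summable fun k : ℕ => ((k : ℝ) + 1) *
      ∫ t in Ioi (0 : ℝ), Real.exp (-(t * (((k : ℝ) + 1) * (a / 2)))) * (|p t| * t) := by
    have h := (classBounds_summable_weighted (V := fun r : ℝ =>
        -(∫ t in Ioi (0 : ℝ), Real.exp (-(t * r)) * (|p t| * t))) hM' hpm' hbd'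
        (fun r _ => rfl) ha2 (le_refl (0 : ℝ))).neg
    refine h.congr fun k => ?_
    simp only [zero_add, mul_neg, neg_neg]
  -- termwise derivatives
  have hg : ∀ (k : ℕ) (y : ℝ), y ∈ Ioi (a / 2) → HasDerivAt (fun b : ℝ => V (((k : ℝ) + 1) * b))
      (((k : ℝ) + 1) * ∫ t in Ioi (0 : ℝ), Real.exp (-(t * (((k : ℝ) + 1) * y))) * p t * t) y := by
    intro k y hy
    have hk : (0 : ℝ) < (k : ℝ) + 1 := by positivity
    have hy0 : 0 < y := ha2.trans hy
    have h1 : HasDerivAt (fun b : ℝ => V (((k : ℝ) + 1) * b))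
        ((∫ t in Ioi (0 : ℝ), Real.exp (-(t * (((k : ℝ) + 1) * y))) * p t * t) *
          (((k : ℝ) + 1) * 1)) y :=
      (zeroPressure_hasDerivAt_potential hpm hbd hV (mul_pos hk hy0)).comp y
        ((hasDerivAt_id' y).const_mul ((k : ℝ) + 1))
    refine h1.congr_deriv ?_
    ring
  -- the uniform bound on `(a/2, ∞)`
  have hg' : ∀ (k : ℕ) (y : ℝ), y ∈ Ioi (a / 2) →
      ‖((k : ℝ) + 1) * ∫ t in Ioi (0 : ℝ), Real.exp (-(t * (((k : ℝ) + 1) * y))) * p t * t‖ ≤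
        ((k : ℝ) + 1) *
          ∫ t in Ioi (0 : ℝ), Real.exp (-(t * (((k : ℝ) + 1) * (a / 2)))) * (|p t| * t) := by
    intro k y hy
    have hk : (0 : ℝ) < (k : ℝ) + 1 := by positivity
    have hy' : a / 2 ≤ y := le_of_lt hy
    rw [Real.norm_eq_abs, abs_mul, abs_of_pos hk]
    exact mul_le_mul_of_nonneg_left (zeroPressure_abs_moment_le hM hpm hbd (mul_pos hk ha2)
      (mul_le_mul_of_nonneg_left hy' hk.le)) hk.le
  -- summability of the chain energy at `a`
  have hg0 : Summable fun k : ℕ => V (((k : ℝ) + 1) * a) :=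
    (classBounds_summable hM hpm hbd hV ha (le_refl (0 : ℝ))).congr fun k => by rw [zero_add]
  -- termwise differentiation
  have hD : HasDerivAt (fun b : ℝ => ∑' k : ℕ, V (((k : ℝ) + 1) * b))
      (∑' k : ℕ, ((k : ℝ) + 1) *
        ∫ t in Ioi (0 : ℝ), Real.exp (-(t * (((k : ℝ) + 1) * a))) * p t * t) a :=
    hasDerivAt_tsum_of_isPreconnected (g := fun (k : ℕ) (b : ℝ) => V (((k : ℝ) + 1) * b))
      (g' := fun (k : ℕ) (y : ℝ) => ((k : ℝ) + 1) *
        ∫ t in Ioi (0 : ℝ), Real.exp (-(t * (((k : ℝ) + 1) * y))) * p t * t)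
      hu isOpen_Ioi isPreconnected_Ioi hg hg' hmem hg0 hmem
  -- Fermat: the derivative vanishes at the interior minimiser
  have hloc : IsLocalMin (fun b : ℝ => ∑' k : ℕ, V (((k : ℝ) + 1) * b)) a :=
    hmin.isLocalMin (Ioi_mem_nhds ha)
  have hzero := hloc.hasDerivAt_eq_zero hD
  have hs : Summable fun k : ℕ => ((k : ℝ) + 1) *
      ∫ t in Ioi (0 : ℝ), Real.exp (-(t * (((k : ℝ) + 1) * a))) * p t * t :=
    Summable.of_norm_bounded hu fun k => hg' k a hmem
  exact hs.hasSum_iff.2 hzero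

end Summit.AtomisticToContinuum.Crystallization.Theorems.ThreeConeCertificateExactCertificate.Transfer1D

end
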